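import Summits.BirchSwinnertonDyer.BirchSwinnertonDyer.Theorems.KimAtThreeDeepLowerOffStratumLevelLoweringMultiStabData
import Literature.NumberTheory.Automorphic.HilbertPartialHasseWeightShiftingProofs
import Literature.NumberTheory.EllipticCurves.EisensteinNewformLevelRaisingDeligneSerreLiftProofs
import HarnessLib

/-!
# Crux U5 `PrintX11a.UpperNonSurjFive` (item stmt-BirchSwinnertonDyer-20614), line «gl1cartan5», EXCEPTIONAL-ZERO road:
# the `𝔭`-adic toolkit at a GENERAL prime `p` (residue field of `𝒪_{ℚ̄_p}`, integrality of eigenform coefficients,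
# congruences of stabilised forms, the roots `α, β` of the Hecke polynomial)

Cell `bsd-print-x11a`, seat `cruxlead-stmt-BirchSwinnertonDyer-20614` (LEAD g6); `--supports stmt-BirchSwinnertonDyer-20614`,
closes nothing. First file of the EXCEPTIONAL-ZERO road of the line (lead g5's RECOMMENDED NEXT: the level-lowering
congruence road into the shallow part «`p` split multiplicative ∧ `Ш(E)[p] = 0` ∧ `ord_p ∏c ≤ 1`» of the core C_exc): the
target is the EXCEPTIONAL-ZERO TAMAGAWA DIVISIBILITY «`p ∣ L(E,1)/Ω_E` at a split multiplicative prime `p ≥ 5` with `E[p]`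
irreducible and `p ∣ ord_p Δ`» (the `p`-stabilisation `g_α` of a level-lowered newform has `{∞,0}_{g_α} = (1 − α⁻¹){∞,0}_g ≡ 0`
since `α ≡ a_p(E) = 1`, and Vatsal's canonical-period congruence transports this to `f_E`). The bsd-addord seat acc2 built
the whole machine at `p = 3` (`Theorems/KimAtThreeDeepLowerOffStratumLevelLowering*.lean`, ≈ 40 files, every `𝔭`-adic
statement typed over `PadicAlgCl 3`); THIS FILE re-proves its `𝔭`-adic bookkeeping over `ℚ̄_p = PadicAlgCl p` for an
arbitrary prime `p` (proofs copied letter for letter with `3 ↦ p`; the `p`-free lemmas of those files — `cuspCoeff_stab`,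
`isNormalized_stab`, `heckeT_stab_*`, `plusSymbol_stab`, `hasSimpleHeckeGenEigenspace_*`, … — are IMPORTED, not copied).
Theorems only: no definition, no named fact, no `sorry`; nothing about any curve is asserted; BSD is not proved by any of this.

* §0 `𝒪 = Valued.integer ℚ̄_p`, `𝓀 = 𝒪/𝔪`: `mem_integer_iff_norm_le_one`, `valuation_{le,lt,eq}_one_iff`,
  `residue_mk_eq_zero_of_norm_lt_one`, `residue_mk_eq_of_norm_sub_lt_one`, `residue_mk_intCast`,
  `charP_residueField`, `two_ne_zero_residueField` (`p ≠ 2`), `norm_ratCast_le_one` (the tree's `p`-generic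
  `DeligneSerreLift.norm_intCast_le_one` / `…_eq_one_of_not_dvd` and `PadicAlgCl.norm_le_one_of_isIntegral` are reused, not restated).
* §1 integrality: `valuation_cuspCoeff_le_one_of_isNewform0`,
  `valuation_cuspCoeff_le_one_of_isNewformOf`, `norm_root_le_one`, `valuation_cuspCoeff_stab_le_one`.
* §2 congruences: `valuation_mul_sub_mul_lt_one`, `valuation_cuspCoeff_sub_lt_one_of_prime` (prime congruences ⇒ all `n`),
  `valuation_cuspCoeff_sub_eq_one_of_congr`, `valuation_cuspCoeff_eq_one_of_mult` (`a_p(E) = ±1` is a unit).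
* (sequel `…ExcToolkitRoots`: the roots `β ≡ uℓ`, `α ≡ u` of `X² − a_ℓX + ℓ` and `c = β/ℓ ≡ 1`.)

## References

* V. Vatsal, *Canonical periods and congruence formulae*, Duke Math. J. 98 (1999), §1. [Vatsal1999]
* F. Diamond, J. Shurman, *A First Course in Modular Forms* (2005), Prop. 5.8.5, §5.7. [DiamondShurman2005]
* G. Shimura, *Introduction to the arithmetic theory of automorphic functions* (1971), Thm. 3.48. [Shimura1971]
* S. Bosch, U. Güntzer, R. Remmert, *Non-Archimedean Analysis* (1984), 3.1.2/1 (spectral norm). [folklore]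
-/

set_option autoImplicit false
-- the Theorems namespace of a single-conjunct summit repeats the summit name by design (D-0017)
set_option linter.dupNamespace false

noncomputable section

open scoped MatrixGroups ModularForm Classical NNReal

open CongruenceSubgroup WeierstrassCurve Polynomial Literature.NumberTheory.EllipticCurves
  Literature.NumberTheory.EllipticCurves.ModularForms

namespace Summit.BirchSwinnertonDyer.BirchSwinnertonDyer.Theorems.GL1Cartan.Exc

open Summit.BirchSwinnertonDyer.BirchSwinnertonDyer.Theorems.KimAtThreeDeepLowerOffStratumLevelLoweringVatsalStab
  (cuspCoeff_stab)
-- `p`-generic tree lemmas reused (not restated): `‖(z : ℚ̄_p)‖ ≤ 1`, `= 1` for `p ∤ z`, algebraic integers have norm `≤ 1`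
open Literature.NumberTheory.EllipticCurves.ModularForms.DeligneSerreLift (norm_intCast_le_one norm_intCast_eq_one_of_not_dvd)
open Literature.NumberTheory.Automorphic (PadicAlgCl.norm_le_one_of_isIntegral)

/-! ### §0 Reduction modulo the maximal ideal of `𝒪_{ℚ̄_p}` -/

section Residue

variable {p : ℕ} [Fact p.Prime]

/-- `‖x‖ ≤ 1` iff `x ∈ 𝒪_{ℚ̄_p}`. [folklore] -/
theorem mem_integer_iff_norm_le_one {x : PadicAlgCl p} :
    x ∈ Valued.integer (PadicAlgCl p) ↔ ‖x‖ ≤ 1 := by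
  rw [Valuation.mem_integer_iff, PadicAlgCl.valuation_def, ← NNReal.coe_le_coe, coe_nnnorm, NNReal.coe_one]

/-- `Valued.v x ≤ 1 ↔ ‖x‖ ≤ 1` on `ℚ̄_p`. [folklore] -/
theorem valuation_le_one_iff {x : PadicAlgCl p} : Valued.v x ≤ 1 ↔ ‖x‖ ≤ 1 := by
  rw [PadicAlgCl.valuation_def, ← NNReal.coe_le_coe, coe_nnnorm, NNReal.coe_one]

/-- `Valued.v x < 1 ↔ ‖x‖ < 1` on `ℚ̄_p`. [folklore] -/
theorem valuation_lt_one_iff {x : PadicAlgCl p} : Valued.v x < 1 ↔ ‖x‖ < 1 := by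
  rw [PadicAlgCl.valuation_def, ← NNReal.coe_lt_coe, coe_nnnorm, NNReal.coe_one]

/-- `Valued.v x = 1 ↔ ‖x‖ = 1` on `ℚ̄_p`. [folklore] -/
theorem valuation_eq_one_iff {x : PadicAlgCl p} : Valued.v x = 1 ↔ ‖x‖ = 1 := by
  rw [PadicAlgCl.valuation_def, ← NNReal.coe_inj, coe_nnnorm, NNReal.coe_one]

/-- An element of `𝒪` of norm `< 1` lies in the maximal ideal: its residue vanishes. [folklore] -/
theorem residue_mk_eq_zero_of_norm_lt_one {x : PadicAlgCl p} (hx : x ∈ Valued.integer (PadicAlgCl p))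
    (h : ‖x‖ < 1) : IsLocalRing.residue (Valued.integer (PadicAlgCl p)) ⟨x, hx⟩ = 0 := by
  rw [IsLocalRing.residue_eq_zero_iff, IsLocalRing.mem_maximalIdeal, mem_nonunits_iff,
    Valuation.Integer.not_isUnit_iff_valuation_lt_one, PadicAlgCl.valuation_def]
  exact_mod_cast h

/-- Elements of `𝒪` congruent modulo `𝔪` have the same residue. [folklore] -/
theorem residue_mk_eq_of_norm_sub_lt_one {x y : PadicAlgCl p} (hx : x ∈ Valued.integer (PadicAlgCl p))
    (hy : y ∈ Valued.integer (PadicAlgCl p)) (h : ‖x - y‖ < 1) :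
    IsLocalRing.residue (Valued.integer (PadicAlgCl p)) ⟨x, hx⟩ =
      IsLocalRing.residue (Valued.integer (PadicAlgCl p)) ⟨y, hy⟩ := by
  rw [← sub_eq_zero, ← map_sub]
  exact residue_mk_eq_zero_of_norm_lt_one (sub_mem hx hy) h

/-- The residue of an integer is its image in `𝓀`. [folklore] -/
theorem residue_mk_intCast (z : ℤ) (hz : (z : PadicAlgCl p) ∈ Valued.integer (PadicAlgCl p)) :
    IsLocalRing.residue (Valued.integer (PadicAlgCl p)) ⟨(z : PadicAlgCl p), hz⟩ = (z : _) := by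
  rw [← map_intCast (IsLocalRing.residue (Valued.integer (PadicAlgCl p))) z]
  rfl

/-- **The residue field `𝓀 = 𝒪_{ℚ̄_p}/𝔪` has characteristic `p`.** [folklore] -/
theorem charP_residueField : CharP (IsLocalRing.ResidueField (Valued.integer (PadicAlgCl p))) p := by
  have hp : p.Prime := Fact.out
  have hlt : ‖((p : ℤ) : PadicAlgCl p)‖ < 1 := by
    rw [show ((p : ℤ) : PadicAlgCl p) = (((p : ℤ) : ℚ_[p]) : PadicAlgCl p) by push_cast; rfl,
      PadicAlgCl.norm_extends]
    exact (Padic.norm_intCast_lt_one_iff (p := p) (k := p)).mpr (dvd_refl _)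
  have h0 : ((p : ℕ) : IsLocalRing.ResidueField (Valued.integer (PadicAlgCl p))) = 0 := by
    have := residue_mk_eq_zero_of_norm_lt_one (mem_integer_iff_norm_le_one.mpr hlt.le) hlt
    rw [residue_mk_intCast] at this
    exact_mod_cast this
  exact (CharP.charP_iff_prime_eq_zero hp).2 h0

/-- `2 ≠ 0` in `𝓀` when `p ≠ 2`. [folklore] -/
theorem two_ne_zero_residueField (hp2 : p ≠ 2) :
    (2 : IsLocalRing.ResidueField (Valued.integer (PadicAlgCl p))) ≠ 0 := by
  haveI := charP_residueField (p := p)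
  have hp : p.Prime := Fact.out
  intro h
  have h' : ((2 : ℕ) : IsLocalRing.ResidueField (Valued.integer (PadicAlgCl p))) = 0 := by exact_mod_cast h
  rw [CharP.cast_eq_zero_iff _ p] at h'
  exact hp2 ((Nat.prime_dvd_prime_iff_eq hp Nat.prime_two).mp h')

/-- A rational with denominator prime to `p` lies in `𝒪_{ℚ̄_p}`. [folklore] -/
theorem norm_ratCast_le_one {r : ℚ} (hr : ¬ p ∣ r.den) : ‖(r : PadicAlgCl p)‖ ≤ 1 := by
  rw [show (r : PadicAlgCl p) = ((r : ℚ_[p]) : PadicAlgCl p) by push_cast; rfl, PadicAlgCl.norm_extends]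
  exact Padic.norm_rat_le_one hr

end Residue

/-! ### §1 Integrality in `ℚ̄_p`: algebraic integers, eigenform coefficients, the root `β` -/

section Integral

variable {p : ℕ} [Fact p.Prime]

/-- The Fourier coefficients of a newform are `p`-adically integral (they are algebraic integers:
`IsNewform0.isIntegral_coeff_holds`, Shimura Thm. 3.48). [cite: Shimura1971, Thm. 3.48] -/
theorem valuation_cuspCoeff_le_one_of_isNewform0 {M : ℕ} [NeZero M] {g : CuspForm (Gamma0 M) 2}
    (hg : IsNewform0 g) (ι : PadicAlgCl p ≃+* ℂ) (n : ℕ) : Valued.v (ι.symm (cuspCoeff g n)) ≤ 1 := by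
  refine valuation_le_one_iff.mpr (PadicAlgCl.norm_le_one_of_isIntegral p ?_)
  have h := IsNewform0.isIntegral_coeff_holds hg n
  exact h.map (ι.symm : ℂ →+* PadicAlgCl p).toIntAlgHom

/-- The coefficients `aₙ(f) = aₙ(E) ∈ ℤ` of the newform of an elliptic curve are `p`-adically integral. [folklore] -/
theorem valuation_cuspCoeff_le_one_of_isNewformOf {W : WeierstrassCurve ℚ} {N : ℕ} [NeZero N]
    {f : CuspForm (Gamma0 N) 2} (hf : IsNewformOf W f) (ι : PadicAlgCl p ≃+* ℂ) (n : ℕ) :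
    Valued.v (ι.symm (cuspCoeff f n)) ≤ 1 := by
  rw [hf.2 n, map_intCast]
  exact valuation_le_one_iff.mpr (norm_intCast_le_one _)

/-- A root `β` of `X² − aX + q` with `a` integral is integral: `‖β‖ ≤ 1` (else `‖β²‖ > ‖aβ − q‖`). [folklore] -/
theorem norm_root_le_one {a b : PadicAlgCl p} {q : ℕ} (ha : ‖a‖ ≤ 1) (hb : b ^ 2 - a * b + q = 0) :
    ‖b‖ ≤ 1 := by
  by_contra h
  push Not at h
  have hb' : b ^ 2 = a * b - q := by linear_combination hb
  have h1 : ‖b ^ 2‖ = ‖b‖ * ‖b‖ := by rw [norm_pow, pow_two]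
  have h2 : ‖a * b - q‖ ≤ max (‖a * b‖) ‖(q : PadicAlgCl p)‖ := by
    rw [sub_eq_add_neg]
    refine (PadicAlgCl.isNonarchimedean p _ _).trans ?_
    rw [norm_neg]
  have h3 : ‖a * b‖ ≤ ‖b‖ := by rw [norm_mul]; exact mul_le_of_le_one_left (norm_nonneg _) ha
  have h4 : ‖(q : PadicAlgCl p)‖ ≤ 1 := by
    have := norm_intCast_le_one (p := p) (q : ℤ)
    rwa [Int.cast_natCast] at this
  have h5 : ‖b‖ * ‖b‖ ≤ ‖b‖ := by
    rw [← h1, hb']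
    exact h2.trans (max_le h3 (h4.trans h.le))
  have hb0 : 0 < ‖b‖ := lt_trans zero_lt_one h
  have h6 : ‖b‖ ≤ 1 := le_of_mul_le_mul_right (by rwa [one_mul]) hb0
  exact (not_le.mpr h) h6

/-- The coefficients of the stabilised form `ι₁ φ − β ι_q φ` are `p`-integral when those of `φ` are and `β` is a
root of the Hecke polynomial at `q`. [cite: Shimura1971, Thm. 3.48] -/
theorem valuation_cuspCoeff_stab_le_one {M q : ℕ} [NeZero q] {φ : CuspForm (Gamma0 M) 2}
    (ι : PadicAlgCl p ≃+* ℂ) (β : ℂ) (h1 : M * 1 ∣ M * q) (hMq : M * q ∣ M * q)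
    (hint : ∀ n : ℕ, Valued.v (ι.symm (cuspCoeff φ n)) ≤ 1)
    (hβ : β ^ 2 - cuspCoeff φ q * β + q = 0) (n : ℕ) :
    Valued.v (ι.symm (cuspCoeff (iota M (M * q) 1 2 h1 φ - β • iota M (M * q) q 2 hMq φ) n)) ≤ 1 := by
  have hβ' : ‖ι.symm β‖ ≤ 1 := by
    refine norm_root_le_one (a := ι.symm (cuspCoeff φ q)) (q := q) (valuation_le_one_iff.mp (hint q)) ?_
    have h := congrArg ι.symm hβ
    rwa [map_add, map_sub, map_pow, map_mul, map_natCast, map_zero] at h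
  have hco := cuspCoeff_stab φ β h1 hMq n
  rw [hco, map_sub, map_mul, sub_eq_add_neg]
  refine valuation_le_one_iff.mpr ((PadicAlgCl.isNonarchimedean p _ _).trans (max_le ?_ ?_))
  · exact valuation_le_one_iff.mp (hint n)
  · rw [norm_neg, norm_mul]
    refine mul_le_one₀ hβ' (norm_nonneg _) ?_
    by_cases hqn : q ∣ n
    · rw [if_pos hqn]
      exact valuation_le_one_iff.mp (hint _)
    · rw [if_neg hqn, map_zero, norm_zero]
      exact zero_le_one

end Integral

/-! ### §2 Congruences -/

section Congruence

variable {p : ℕ} [Fact p.Prime] {L : ℕ} [NeZero L]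

/-- Ultrametric bookkeeping: `v(xy − zw) < 1` if `v(x − z) < 1`, `v(y − w) < 1` and `x, w` are integral. [folklore] -/
theorem valuation_mul_sub_mul_lt_one {x y z w : PadicAlgCl p} (hx : Valued.v x ≤ 1) (hw : Valued.v w ≤ 1)
    (hxz : Valued.v (x - z) < 1) (hyw : Valued.v (y - w) < 1) : Valued.v (x * y - z * w) < 1 := by
  have : x * y - z * w = x * (y - w) + (x - z) * w := by ring
  rw [this]
  refine lt_of_le_of_lt (Valuation.map_add _ _ _) (max_lt ?_ ?_)
  · rw [Valuation.map_mul]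
    calc Valued.v x * Valued.v (y - w) ≤ 1 * Valued.v (y - w) := mul_le_mul' hx le_rfl
      _ < 1 := by rw [one_mul]; exact hyw
  · rw [Valuation.map_mul]
    calc Valued.v (x - z) * Valued.v w ≤ Valued.v (x - z) * 1 := mul_le_mul' le_rfl hw
      _ < 1 := by rw [mul_one]; exact hxz

/-- **Two normalised Hecke eigenforms of the same level `Γ₀(L)` and weight `2` with `p`-integral coefficients
whose PRIME coefficients are congruent modulo `𝔪` have ALL coefficients congruent** (strong induction on `n`
through the Hecke recursion `a_{ℓm} = a_ℓ a_m − 𝟙_{ℓ∤L} ℓ 𝟙_{ℓ∣m} a_{m/ℓ}`, Diamond–Shurman Prop. 5.8.5).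
[cite: DiamondShurman2005, Prop. 5.8.5] -/
theorem valuation_cuspCoeff_sub_lt_one_of_prime (ι : PadicAlgCl p ≃+* ℂ) {h₁ h₂ : CuspForm (Gamma0 L) 2}
    (e₁ : IsHeckeEigenform h₁) (e₂ : IsHeckeEigenform h₂) (n₁ : IsNormalized h₁) (n₂ : IsNormalized h₂)
    (i₁ : ∀ n : ℕ, Valued.v (ι.symm (cuspCoeff h₁ n)) ≤ 1) (i₂ : ∀ n : ℕ, Valued.v (ι.symm (cuspCoeff h₂ n)) ≤ 1)
    (hc : ∀ ℓ : ℕ, ℓ.Prime → Valued.v (ι.symm (cuspCoeff h₁ ℓ - cuspCoeff h₂ ℓ)) < 1) (n : ℕ) :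
    Valued.v (ι.symm (cuspCoeff h₁ n - cuspCoeff h₂ n)) < 1 := by
  induction n using Nat.strong_induction_on with
  | _ n ih =>
    rcases eq_or_ne n 0 with rfl | hn0
    · rw [cuspCoeff, cuspCoeff, CuspFormClass.qExpansion_coeff_zero h₁ one_pos (one_mem_strictPeriods_gamma0 L),
        CuspFormClass.qExpansion_coeff_zero h₂ one_pos (one_mem_strictPeriods_gamma0 L), sub_zero, map_zero,
        Valuation.map_zero]
      exact zero_lt_one
    rcases eq_or_ne n 1 with rfl | hn1
    · rw [show cuspCoeff h₁ 1 = 1 from n₁, show cuspCoeff h₂ 1 = 1 from n₂, sub_self, map_zero, Valuation.map_zero]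
      exact zero_lt_one
    set ℓ := n.minFac with hℓ_def
    have hℓ : ℓ.Prime := Nat.minFac_prime hn1
    obtain ⟨m, hm⟩ : ℓ ∣ n := Nat.minFac_dvd n
    have hm0 : m ≠ 0 := by rintro rfl; simp at hm; exact hn0 hm
    have hmn : m < n := by rw [hm]; exact lt_mul_left (Nat.pos_of_ne_zero hm0) hℓ.one_lt
    have hrec : ∀ {h : CuspForm (Gamma0 L) 2}, IsHeckeEigenform h → IsNormalized h →
        cuspCoeff h n = cuspCoeff h ℓ * cuspCoeff h m -
          (if ℓ ∣ L then 0 else (ℓ : ℂ) * (if ℓ ∣ m then cuspCoeff h (m / ℓ) else 0)) := by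
      intro h e nn
      have hr := heckeEigenvalue_mul_coeff e hℓ m
      rw [heckeEigenvalue_eq_coeff_of_isNormalized nn hℓ (e ℓ hℓ), ← hm, show ((2 : ℤ) - 1) = 1 by norm_num,
        zpow_one] at hr
      simp only [cuspCoeff] at hr ⊢
      rw [hr]; ring
    rw [hrec e₁ n₁, hrec e₂ n₂]
    have hA : Valued.v (ι.symm (cuspCoeff h₁ ℓ * cuspCoeff h₁ m - cuspCoeff h₂ ℓ * cuspCoeff h₂ m)) < 1 := by
      rw [map_sub, map_mul, map_mul]
      exact valuation_mul_sub_mul_lt_one (i₁ ℓ) (i₂ m) (by rw [← map_sub]; exact hc ℓ hℓ)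
        (by rw [← map_sub]; exact ih m hmn)
    have hB : Valued.v (ι.symm ((if ℓ ∣ L then 0 else (ℓ : ℂ) * (if ℓ ∣ m then cuspCoeff h₁ (m / ℓ) else 0)) -
        (if ℓ ∣ L then 0 else (ℓ : ℂ) * (if ℓ ∣ m then cuspCoeff h₂ (m / ℓ) else 0)))) < 1 := by
      split_ifs with hL hℓm
      · rw [sub_self, map_zero, Valuation.map_zero]; exact zero_lt_one
      · rw [← mul_sub, map_mul, Valuation.map_mul, map_natCast]
        have hℓint : Valued.v ((ℓ : ℕ) : PadicAlgCl p) ≤ 1 := by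
          have h3 := norm_intCast_le_one (p := p) (ℓ : ℤ)
          rw [Int.cast_natCast] at h3
          exact valuation_le_one_iff.mpr h3
        have hmℓ : m / ℓ < n := lt_of_le_of_lt (Nat.div_le_self m ℓ) hmn
        calc Valued.v ((ℓ : ℕ) : PadicAlgCl p) * Valued.v (ι.symm (cuspCoeff h₁ (m / ℓ) - cuspCoeff h₂ (m / ℓ)))
            ≤ 1 * Valued.v (ι.symm (cuspCoeff h₁ (m / ℓ) - cuspCoeff h₂ (m / ℓ))) := mul_le_mul' hℓint le_rfl
          _ < 1 := by rw [one_mul]; exact ih (m / ℓ) hmℓ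
      · rw [mul_zero, sub_self, map_zero, Valuation.map_zero]; exact zero_lt_one
    have : ι.symm (cuspCoeff h₁ ℓ * cuspCoeff h₁ m -
          (if ℓ ∣ L then 0 else (ℓ : ℂ) * (if ℓ ∣ m then cuspCoeff h₁ (m / ℓ) else 0)) -
        (cuspCoeff h₂ ℓ * cuspCoeff h₂ m -
          (if ℓ ∣ L then 0 else (ℓ : ℂ) * (if ℓ ∣ m then cuspCoeff h₂ (m / ℓ) else 0)))) =
        ι.symm (cuspCoeff h₁ ℓ * cuspCoeff h₁ m - cuspCoeff h₂ ℓ * cuspCoeff h₂ m) -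
        ι.symm ((if ℓ ∣ L then 0 else (ℓ : ℂ) * (if ℓ ∣ m then cuspCoeff h₁ (m / ℓ) else 0)) -
          (if ℓ ∣ L then 0 else (ℓ : ℂ) * (if ℓ ∣ m then cuspCoeff h₂ (m / ℓ) else 0))) := by
      rw [← map_sub]; congr 1; ring
    rw [this]
    exact lt_of_le_of_lt (Valuation.map_sub _ _ _) (max_lt hA hB)

/-- **The non-Eisenstein unit for `g` from the numeral for `E`**: if `a ∈ ℤ`, `a ≡ a_{r₀}(g) (mod 𝔪)` and
`p ∤ a − r₀ − 1`, then `a_{r₀}(g) − (r₀ + 1)` is a unit. [folklore] -/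
theorem valuation_cuspCoeff_sub_eq_one_of_congr (ι : PadicAlgCl p ≃+* ℂ) {M : ℕ} {g : CuspForm (Gamma0 M) 2}
    {r₀ : ℕ} {a : ℤ} (ha : ¬ (p : ℤ) ∣ a - (r₀ + 1))
    (hcong : Valued.v (ι.symm ((a : ℂ) - cuspCoeff g r₀)) < 1) :
    Valued.v (ι.symm (cuspCoeff g r₀ - (r₀ + 1))) = 1 := by
  rw [valuation_eq_one_iff]
  have hu : ‖(((a - (r₀ + 1) : ℤ)) : PadicAlgCl p)‖ = 1 := norm_intCast_eq_one_of_not_dvd ha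
  have hsmall : ‖ι.symm ((a : ℂ) - cuspCoeff g r₀)‖ < 1 := valuation_lt_one_iff.mp hcong
  have heq : ι.symm (cuspCoeff g r₀ - (r₀ + 1)) =
      (((a - (r₀ + 1) : ℤ)) : PadicAlgCl p) + -ι.symm ((a : ℂ) - cuspCoeff g r₀) := by
    push_cast
    rw [map_sub, map_sub, map_add, map_intCast, map_natCast, map_one]
    ring
  rw [heq]
  refine le_antisymm ?_ ?_
  · refine (PadicAlgCl.isNonarchimedean p _ _).trans (max_le hu.le ?_)
    rw [norm_neg]; exact hsmall.le
  · have h := IsUltrametricDist.norm_add_eq_max_of_norm_ne_norm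
      (x := (((a - (r₀ + 1) : ℤ)) : PadicAlgCl p)) (y := -ι.symm ((a : ℂ) - cuspCoeff g r₀))
      (by rw [hu, norm_neg]; exact (ne_of_lt hsmall).symm)
    rw [h, hu]
    exact le_max_left _ _

/-- At a prime `p` of multiplicative reduction `a_p(E) = ±1` is a `p`-adic unit (Silverman *AEC* §C.16; tree
`LFunction_prime_pow_of_hasMultiplicativeReductionAtPrime`). [cite: SilvermanAEC2009, §C.16 (definition of L_v(T))] -/
theorem valuation_cuspCoeff_eq_one_of_mult (ι : PadicAlgCl p ≃+* ℂ) (W : WeierstrassCurve ℚ) [W.IsElliptic] {N : ℕ}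
    [NeZero N] {f : CuspForm (Gamma0 N) 2} (hf : IsNewformOf W f)
    (hmult : W.HasMultiplicativeReductionAtPrime p) : Valued.v (ι.symm (cuspCoeff f p)) = 1 := by
  have hsq : W.LFunction p ^ 2 = 1 := (LFunction_prime_pow_of_hasMultiplicativeReductionAtPrime W p hmult 0).2
  rw [hf.2 p, map_intCast]
  refine valuation_eq_one_iff.mpr ?_
  have h : ‖((W.LFunction p : ℤ) : PadicAlgCl p)‖ ^ 2 = 1 := by
    rw [← norm_pow, ← Int.cast_pow, hsq, Int.cast_one, norm_one]
  exact (pow_eq_one_iff_of_nonneg (norm_nonneg _) two_ne_zero).mp h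

end Congruence

end Summit.BirchSwinnertonDyer.BirchSwinnertonDyer.Theorems.GL1Cartan.Exc

end
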